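import Mathlib
import Summits.Ventures.PercRepro2.CoinChainXAClosedGate
import Summits.Ventures.PercRepro2.CoinChainReductionGen
import Summits.Ventures.PercRepro2.CoinChainHeadHyps

/-!
# The general AND-switch chain and row 2′DARC at the CLOSED gate
(blind cell PercRepro2, night-2 g30)

`chain_functional_nonneg_closed_gate`: the general AND-switch chain (ARBITRARY sure entries `ent`
and coin entries `ent'`) at every `ρ ∈ [0, 1]` with the closed gate `d' ≡ 0`, for every pair of
nonnegative increasing markers (`x ≤ 1`) vanishing on the entry-free ideal — from
`chain_functional_nonneg_of_XA'` and `chain_XA'_closed_gate`.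
`darc_of_chain_closed_gate`: row 2′DARC at the general chain for every pair of ENTRY markers
`m₁, m₂ ∈ ent ∪ ent'` whenever the gate head `chainD'` vanishes identically (once the free-arc
vertex `a` is entered, the arc `a → w` always connects `s` to `t` — e.g. `w` surely connected
to `t`), with positive world masses and ideal mass and an lsm core.
-/

namespace Summit.Ventures.PercRepro2.Coin

open Classical

section ClosedGateChain

variable {V : Type*} [DecidableEq V] {R : Type*} [Field R] [LinearOrder R] [IsStrictOrderedRing R]

/-- **THE GENERAL AND-SWITCH CHAIN AT THE CLOSED GATE** `d' ≡ 0`, at every `ρ ∈ [0, 1]`, for every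
entry structure and every pair of nonnegative increasing markers (`x ≤ 1`) that vanish on the
entry-free ideal (positive world masses and ideal mass). -/
theorem chain_functional_nonneg_closed_gate (U ent ent' : Finset V) (ν c d : Finset V → R)
    (ρ : R) (hρ0 : 0 ≤ ρ) (hρ1 : ρ ≤ 1) (hν0 : ∀ W, 0 ≤ ν W)
    (hν : ∀ s ⊆ U, ∀ t ⊆ U, ν s * ν t ≤ ν (s ∩ t) * ν (s ∪ t))
    (hc0 : ∀ W, 0 ≤ c W) (hd0 : ∀ W, 0 ≤ d W) (hdc : ∀ W, d W ≤ c W)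
    (hcc : ∀ s t, c s * c t ≤ c (s ∩ t) * c (s ∪ t))
    (hdd : ∀ s t, d s * d t ≤ d (s ∩ t) * d (s ∪ t))
    (hcd : ∀ s t, c s * d t ≤ c (s ∩ t) * d (s ∪ t))
    (hratio : ∀ s t, s ⊆ t → d s * c t ≤ c s * d t)
    (x y : Finset V → R) (hx0 : ∀ W, 0 ≤ x W) (hy0 : ∀ W, 0 ≤ y W)
    (hx1 : ∀ W, x W ≤ 1)
    (hxm : ∀ s t, x s ≤ x (s ∪ t)) (hym : ∀ s t, y s ≤ y (s ∪ t))
    (hxI : ∀ W, (¬ ∃ r ∈ ent ∪ ent', r ∈ W) → x W = 0)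
    (hyI : ∀ W, (¬ ∃ r ∈ ent ∪ ent', r ∈ W) → y W = 0)
    (hpos0 : 0 < ∑ W ∈ U.powerset, ν W * chainMix ent ent' 0 c d W)
    (hpos1 : 0 < ∑ W ∈ U.powerset, ν W * chainMix ent ent' 1 c d W)
    (hmI : 0 < ∑ W ∈ U.powerset.filter (fun W => ¬ ∃ r ∈ ent ∪ ent', r ∈ W), ν W * c W) :
    0 ≤ (∑ W ∈ U.powerset, ν W * chainMix ent ent' ρ c d W) ^ 2 *
          (∑ W ∈ U.powerset, ν W * chainMix ent ent' ρ c (fun _ => (0 : R)) W * (x W * y W))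
        - (∑ W ∈ U.powerset, ν W * chainMix ent ent' ρ c d W) *
          (∑ W ∈ U.powerset, ν W * chainMix ent ent' ρ c d W * x W) *
          (∑ W ∈ U.powerset, ν W * chainMix ent ent' ρ c (fun _ => (0 : R)) W * y W)
        - (∑ W ∈ U.powerset, ν W * chainMix ent ent' ρ c d W) *
          (∑ W ∈ U.powerset, ν W * chainMix ent ent' ρ c d W * y W) *
          (∑ W ∈ U.powerset, ν W * chainMix ent ent' ρ c (fun _ => (0 : R)) W * x W)
        + (∑ W ∈ U.powerset, ν W * chainMix ent ent' ρ c d W * x W) *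
          (∑ W ∈ U.powerset, ν W * chainMix ent ent' ρ c d W * y W) *
          (∑ W ∈ U.powerset, ν W * chainMix ent ent' ρ c (fun _ => (0 : R)) W) :=
  chain_functional_nonneg_of_XA' U ent ent' ν c d (fun _ => (0 : R)) ρ hρ0 hρ1 hν0 hν hc0 hd0
    (fun _ => le_rfl) hdc (fun W => hc0 W) (fun W => hd0 W) hcc hdd
    (fun _ _ => by simp) hcd (fun _ _ => by simp) (fun _ _ => by simp) hratio (fun _ _ _ => by simp)
    x y hx0 hy0 hxm hym hpos0 hpos1 hmI
    (chain_XA'_closed_gate U ent ent' ν c d hν0 hν hc0 hd0 hdc hcd hratio x y hx0 hy0 hx1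
      hxm hym hxI hyI)

end ClosedGateChain

section ClosedGateDarc

variable {V : Type*} {E : Type*} [Fintype V] [DecidableEq V] [Fintype E] [DecidableEq E]
  {R : Type*} [Field R] [LinearOrder R] [IsStrictOrderedRing R]
  {arcs : E → Finset (V × V)} {s : V} {U : Finset V} {ent ent' : Finset V} {c' c : V → E}
  {a' a w : V}

/-- **ROW 2′DARC AT THE GENERAL AND-SWITCH CHAIN AT THE CLOSED GATE**: chain data `ν = P(level)`,
`c = chainC`, `d = chainD`, the gate head `chainD' ≡ 0` (the free arc `a → w` always connects `s` to
`t` once `a` is entered), ENTRY markers `m₁, m₂ ∈ ent ∪ ent'` (with `m₁, m₂ ∈ U`), an lsm core,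
positive world masses and ideal mass: `DARC pr arcs s {t} m₁ m₂ a w`. -/
theorem darc_of_chain_closed_gate (pr : E → R) (hp : IsProbVec pr) (hS : SameEnds arcs)
    (h' : OrTailK arcs s U ent' c' a') (hsure' : ∀ r ∈ ent', pr (c' r) = 1)
    (h : OrTailK arcs s (insert a' U) (insert a' ent) c a) (hsure : ∀ r ∈ ent, pr (c r) = 1)
    (hentU : ent ⊆ U)
    {m₁ m₂ : V} (hm₁ : m₁ ∈ U) (hm₂ : m₂ ∈ U) (hm₁E : m₁ ∈ ent ∪ ent') (hm₂E : m₂ ∈ ent ∪ ent')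
    (hν : ∀ W W', W ⊆ U → W' ⊆ U →
      prob pr (coreLevel arcs s U W) * prob pr (coreLevel arcs s U W') ≤
        prob pr (coreLevel arcs s U (W ∩ W')) * prob pr (coreLevel arcs s U (W ∪ W')))
    {t : V} (htC : t ∉ insert a (insert a' U)) (hts : t ≠ s) (hws : w ≠ s)
    (hwC : w ∉ insert a (insert a' U))
    (h0 : ∀ W, chainD' pr arcs s t U ent' a' a w W = 0)
    (hpos0 : 0 < ∑ W ∈ U.powerset, prob pr (coreLevel arcs s U W) *
      chainMix ent ent' 0 (chainC pr arcs s t U ent' a' a) (chainD pr arcs s t U ent' a' a) W)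
    (hpos1 : 0 < ∑ W ∈ U.powerset, prob pr (coreLevel arcs s U W) *
      chainMix ent ent' 1 (chainC pr arcs s t U ent' a' a) (chainD pr arcs s t U ent' a' a) W)
    (hmI : 0 < ∑ W ∈ U.powerset.filter (fun W => ¬ ∃ r ∈ ent ∪ ent', r ∈ W),
      prob pr (coreLevel arcs s U W) * chainC pr arcs s t U ent' a' a W) :
    DARC pr arcs s {t} m₁ m₂ a w := by
  obtain ⟨hA0, hAmono, hAlsm⟩ := OrTailU.head_props (U := insert a' U) (a := a) pr hp hS t
  obtain ⟨hdc, -, hcc, hdd, -, -, hratio, -, -, hcd, -⟩ :=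
    chainPhi_head_hyps (fun X => prob pr (coreAvoidEvent arcs s t (insert a (insert a' U)) X))
      ent' a' a w hA0 hAmono hAlsm
  have hx0 : ∀ W : Finset V, (0 : R) ≤ (if m₁ ∈ W then (1 : R) else 0) := by
    intro W; split_ifs <;> norm_num
  have hy0 : ∀ W : Finset V, (0 : R) ≤ (if m₂ ∈ W then (1 : R) else 0) := by
    intro W; split_ifs <;> norm_num
  have hx1 : ∀ W : Finset V, (if m₁ ∈ W then (1 : R) else 0) ≤ 1 := by
    intro W; split_ifs <;> norm_num
  have hxm : ∀ s t : Finset V,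
      (if m₁ ∈ s then (1 : R) else 0) ≤ (if m₁ ∈ s ∪ t then (1 : R) else 0) := by
    intro s t
    by_cases h : m₁ ∈ s
    · rw [if_pos h, if_pos (Finset.mem_union_left t h)]
    · rw [if_neg h]; split_ifs <;> norm_num
  have hym : ∀ s t : Finset V,
      (if m₂ ∈ s then (1 : R) else 0) ≤ (if m₂ ∈ s ∪ t then (1 : R) else 0) := by
    intro s t
    by_cases h : m₂ ∈ s
    · rw [if_pos h, if_pos (Finset.mem_union_left t h)]
    · rw [if_neg h]; split_ifs <;> norm_num
  have hxI : ∀ W : Finset V, (¬ ∃ r ∈ ent ∪ ent', r ∈ W) → (if m₁ ∈ W then (1 : R) else 0) = 0 := by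
    intro W hW
    rw [if_neg (fun hm => hW ⟨m₁, hm₁E, hm⟩)]
  have hyI : ∀ W : Finset V, (¬ ∃ r ∈ ent ∪ ent', r ∈ W) → (if m₂ ∈ W then (1 : R) else 0) = 0 := by
    intro W hW
    rw [if_neg (fun hm => hW ⟨m₂, hm₂E, hm⟩)]
  have hD' : chainD' pr arcs s t U ent' a' a w = fun _ => (0 : R) := funext h0
  refine chain_darc_of_functional pr hS h' hsure' h hsure hentU hm₁ hm₂ htC hts hws hwC ?_
  rw [hD']
  exact chain_functional_nonneg_closed_gate U ent ent' (fun W => prob pr (coreLevel arcs s U W))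
    (chainC pr arcs s t U ent' a' a) (chainD pr arcs s t U ent' a' a)
    (pr (c a')) (hp.nonneg _) (hp.le_one _) (fun W => prob_nonneg hp _)
    (fun s' hs' t' ht' => hν s' t' hs' ht') (fun W => hA0 _) (fun W => hA0 _)
    hdc hcc hdd hcd hratio
    (fun W => if m₁ ∈ W then (1 : R) else 0) (fun W => if m₂ ∈ W then (1 : R) else 0)
    hx0 hy0 hx1 hxm hym hxI hyI hpos0 hpos1 hmI

end ClosedGateDarc

end Summit.Ventures.PercRepro2.Coin
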